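import Literature.AnabelianGeometry.AbsoluteAnabelian.ProSigmaMaximalQuotientKernel
import Literature.AnabelianGeometry.AbsoluteAnabelian.AbsTopISemiAbsolute
import Mathlib.Topology.Algebra.Group.Quotient
import HarnessLib

/-!
# "Any almost pro-`Σ`-maximal quotient of `G` is almost pro-`Σ`" ([AbsTopI] Def 1.1 (iii), the bracket)

S. Mochizuki, *Topics in Absolute Anabelian Geometry I: Generalities* (2012) [AbsTopI] (lit key
`paper:url-11ac98ba15fc`), Def 1.1 (iii) p. 10: "If `G` admits an open subgroup which is pro-`Σ`, then
we shall say that `G` is almost pro-`Σ`.  We shall refer to a quotient `G ↠ Q` as almost pro-`Σ`-maximal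
if for some normal open subgroup `N ⊆ G` with maximal pro-`Σ` quotient `N ↠ P`, we have
`Ker(G ↠ Q) = Ker(N ↠ P)`.  [Thus, any almost pro-`Σ`-maximal quotient of `G` is almost pro-`Σ`.]"

PROOF-ONLY sequel to `ProSigmaMaximalQuotientKernel.lean` (kernel `K = Ker(N ↠ P)` by the membership
hypothesis; typed predicates `IsProSet`, `IsAlmostPro` of `AbsTopISemiAbsolute.lean`):

* `mem_of_prime_dvd_index_of_le` — an OPEN subgroup `U ⊇ K` has only primes of `Σ` dividing its index
  (it contains a finite intersection of open normal `Σ`-index subgroups, by compactness);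
* `isProSet_of_surjective_of_le` — the target of a continuous surjection `G ↠ H` killing `K` is
  pro-`Σ`; in particular `isProSet_quotient` — **`P = G/K` is pro-`Σ`** (it IS the maximal pro-`Σ`
  quotient: pro-`Σ`, and every pro-`Σ` quotient factors through it by the definition of `K`);
* `map_eq_one_of_isProSet` — maximality: every continuous surjection of `G` onto a profinite pro-`Σ`
  group kills `K` (so factors through `G/K`);
* `exists_proSigmaKernel`, `exists_proSigmaKernel_subgroup` — the membership hypothesis is satisfiable
  (the infimum of the family), so every theorem of the package applies to an actual `K = Ker(N ↠ P)`;
* `isAlmostPro_quotient_proSigmaKernel` — **the bracket**: for `N ⊆ G` open and `K_Σ = Ker(N ↠ P)`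
  normal in `G`, the quotient `G/K_Σ` is almost pro-`Σ` (its open subgroup `N/K_Σ ≅ P` is pro-`Σ`).

Classical; nothing here bears on [IUTchIII] Cor. 3.12.
-/

noncomputable section

open Topology

universe u v

namespace Literature.AnabelianGeometry.AbsoluteAnabelian

open Literature.AnabelianGeometry.Anabelioids (IsSigmaInteger)

variable {G : Type u} [Group G] [TopologicalSpace G] [IsTopologicalGroup G] {S : Set ℕ} {K : Subgroup G}

/-- An open subgroup `U ⊇ K = Ker(G ↠ P)` has `Σ`-index up to primes: every prime dividing `[G : U]`
lies in `Σ` (`U` contains a finite intersection of open normal `Σ`-index subgroups, by compactness).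
[cite: MochizukiAbsTopI2012, Def 1.1 (iii) p.10] -/
theorem mem_of_prime_dvd_index_of_le [CompactSpace G]
    (hK : ∀ x, x ∈ K ↔ ∀ W : Subgroup G, W.Normal → IsOpen (W : Set G) → IsSigmaInteger S W.index → x ∈ W)
    {U : Subgroup G} (hUo : IsOpen (U : Set G)) (hKU : K ≤ U) {q : ℕ} (hq : q.Prime)
    (hdvd : q ∣ U.index) : q ∈ S := by
  classical
  obtain ⟨F, hFP, hFle⟩ := exists_finset_of_isOpen_of_forall_mem
    (fun W : Subgroup G => W.Normal ∧ IsOpen (W : Set G) ∧ IsSigmaInteger S W.index)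
    (fun W hW => Subgroup.isClosed_of_isOpen W hW.2.1) U hUo
    (fun x hx => hKU ((hK x).mpr fun W hWn hWo hWS => hx W ⟨hWn, hWo, hWS⟩))
  obtain ⟨-, -, hFS⟩ := finset_inf_normal_isOpen_isSigmaInteger F hFP
  have hle : F.inf id ≤ U := fun x hx => hFle x ((mem_finset_inf_iff F x).mp hx)
  exact hFS.2 q hq (hdvd.trans (Subgroup.index_dvd_of_le hle))

/-- The target of a continuous surjective homomorphism `f : G ↠ H` with `K ⊆ Ker f` is pro-`Σ`.
[cite: MochizukiAbsTopI2012, Def 1.1 (iii) p.10] -/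
theorem isProSet_of_surjective_of_le [CompactSpace G]
    (hK : ∀ x, x ∈ K ↔ ∀ W : Subgroup G, W.Normal → IsOpen (W : Set G) → IsSigmaInteger S W.index → x ∈ W)
    {H : Type v} [Group H] [TopologicalSpace H] (f : G →* H) (hf : Continuous f)
    (hfs : Function.Surjective f) (hKf : ∀ k ∈ K, f k = 1) : IsProSet H S := by
  refine ⟨fun U _ hUo q hq hdvd => ?_⟩
  have hKU : K ≤ U.comap f := fun k hk => by
    rw [Subgroup.mem_comap, hKf k hk]; exact U.one_mem
  refine mem_of_prime_dvd_index_of_le hK (hUo.preimage hf) hKU hq ?_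
  rwa [Subgroup.index_comap_of_surjective U hfs]

/-- **`P = G/K` is pro-`Σ`** (`K = Ker(G ↠ P)` the kernel of the maximal pro-`Σ` quotient).
[cite: MochizukiAbsTopI2012, Def 1.1 (iii) p.10] -/
theorem isProSet_quotient [CompactSpace G]
    (hK : ∀ x, x ∈ K ↔ ∀ W : Subgroup G, W.Normal → IsOpen (W : Set G) → IsSigmaInteger S W.index → x ∈ W)
    [K.Normal] : IsProSet (G ⧸ K) S :=
  isProSet_of_surjective_of_le hK (QuotientGroup.mk' K) QuotientGroup.continuous_mk
    (QuotientGroup.mk'_surjective K) fun k hk => (QuotientGroup.eq_one_iff k).mpr hk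

/-- **[AbsTopI] Def 1.1 (iii), the bracket: "any almost pro-`Σ`-maximal quotient of `G` is almost
pro-`Σ`."**  For `N ⊆ G` open (in a compact group) and `K_Σ` the kernel of the maximal pro-`Σ`
quotient of `N` (membership hypothesis inside `N`, which forces `K_Σ ∩ N = Ker(N ↠ P)`), normal in `G`: the quotient `Q = G/K_Σ` admits the
open pro-`Σ` subgroup `N/K_Σ` (the image of `N`). [cite: MochizukiAbsTopI2012, Def 1.1 (iii) p.10] -/
theorem isAlmostPro_quotient_proSigmaKernel [CompactSpace G] (N : Subgroup G)
    (hNo : IsOpen (N : Set G)) (KS : Subgroup G) [KS.Normal]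
    (hKS : ∀ x : N, (x : G) ∈ KS ↔
      ∀ W : Subgroup N, W.Normal → IsOpen (W : Set N) → IsSigmaInteger S W.index → x ∈ W) :
    IsAlmostPro (G ⧸ KS) S := by
  classical
  haveI : CompactSpace N :=
    isCompact_iff_compactSpace.mp (Subgroup.isClosed_of_isOpen N hNo).isCompact
  let π : G →* G ⧸ KS := QuotientGroup.mk' KS
  let H : Subgroup (G ⧸ KS) := N.map π
  have hHo : IsOpen (H : Set (G ⧸ KS)) := by
    have : (H : Set (G ⧸ KS)) = π '' (N : Set G) := Subgroup.coe_map _ _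
    rw [this]
    exact QuotientGroup.isOpenMap_coe _ hNo
  refine ⟨H, hHo, ?_⟩
  -- `N ↠ H`, killing `K' = KS ∩ N`
  let K' : Subgroup N := KS.subgroupOf N
  have hK' : ∀ x : N, x ∈ K' ↔
      ∀ W : Subgroup N, W.Normal → IsOpen (W : Set N) → IsSigmaInteger S W.index → x ∈ W := by
    intro x; rw [Subgroup.mem_subgroupOf]; exact hKS x
  let r : N →* H :=
    { toFun := fun n => ⟨π (n : G), ⟨n, n.2, rfl⟩⟩
      map_one' := Subtype.ext (by simp)
      map_mul' := fun a b => Subtype.ext (by simp) }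
  have hrc : Continuous r := (QuotientGroup.continuous_mk.comp continuous_subtype_val).subtype_mk _
  have hrs : Function.Surjective r := by
    rintro ⟨y, hy⟩
    obtain ⟨n, hn, rfl⟩ := hy
    exact ⟨⟨n, hn⟩, rfl⟩
  refine isProSet_of_surjective_of_le hK' r hrc hrs fun k hk => Subtype.ext ?_
  change π (k : G) = 1
  exact (QuotientGroup.eq_one_iff (k : G)).mpr (Subgroup.mem_subgroupOf.mp hk)

/-! ### Maximality: every pro-`Σ` quotient of `G` factors through `G/K` -/

omit [IsTopologicalGroup G] in
/-- **`G/K` is the MAXIMAL pro-`Σ` quotient**: a continuous surjection `f : G ↠ P'` onto a profinite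
pro-`Σ` group kills `K` — each open normal `V ⊴ P'` has `Σ`-integer index, so `f⁻¹(V)` is an open
normal `Σ`-index subgroup of `G`, whence `K ⊆ f⁻¹(V)`; and `⋂ V = 1` in the profinite `P'`.
[cite: MochizukiAbsTopI2012, Def 1.1 (iii) p.10] -/
theorem map_eq_one_of_isProSet
    (hK : ∀ x, x ∈ K ↔ ∀ W : Subgroup G, W.Normal → IsOpen (W : Set G) → IsSigmaInteger S W.index → x ∈ W)
    {P' : Type v} [Group P'] [TopologicalSpace P'] [IsTopologicalGroup P'] [CompactSpace P']
    [T2Space P'] [TotallyDisconnectedSpace P'] (f : G →* P') (hf : Continuous f)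
    (hfs : Function.Surjective f) (hP' : IsProSet P' S) {k : G} (hk : k ∈ K) : f k = 1 := by
  classical
  by_contra hne
  -- an open normal subgroup of `P'` missing `f k`
  have hO : IsOpen ({f k}ᶜ : Set P') := isOpen_compl_singleton
  have h1O : (1 : P') ∈ ({f k}ᶜ : Set P') := fun h => hne (Set.mem_singleton_iff.mp h).symm
  obtain ⟨V, hV⟩ := ProfiniteGrp.exist_openNormalSubgroup_sub_open_nhds_of_one hO h1O
  -- its preimage is an open normal `Σ`-index subgroup of `G`, hence contains `K`
  let W : Subgroup G := (V.toOpenSubgroup.toSubgroup).comap f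
  haveI : (V.toOpenSubgroup.toSubgroup).Normal := V.isNormal'
  have hWn : W.Normal := inferInstance
  have hWo : IsOpen (W : Set G) := V.toOpenSubgroup.isOpen.preimage hf
  have hVidx : IsSigmaInteger S (V.toOpenSubgroup.toSubgroup).index := by
    haveI : Finite (P' ⧸ V.toOpenSubgroup.toSubgroup) :=
      Subgroup.quotient_finite_of_isOpen _ V.toOpenSubgroup.isOpen
    haveI : (V.toOpenSubgroup.toSubgroup).FiniteIndex := Subgroup.finiteIndex_of_finite_quotient
    refine ⟨Nat.pos_of_ne_zero Subgroup.FiniteIndex.index_ne_zero, fun q hq hqd => ?_⟩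
    exact hP'.prime_dvd_index _ V.isNormal' V.toOpenSubgroup.isOpen q hq hqd
  have hWS : IsSigmaInteger S W.index := by
    change IsSigmaInteger S ((V.toOpenSubgroup.toSubgroup).comap f).index
    rw [Subgroup.index_comap_of_surjective _ hfs]
    exact hVidx
  have hkW : k ∈ W := (hK k).mp hk W hWn hWo hWS
  rw [Subgroup.mem_comap] at hkW
  exact hV hkW rfl

/-! ### Existence of the kernel `K = Ker(G ↠ P)` (discharging the membership hypothesis) -/

omit [TopologicalSpace G] [IsTopologicalGroup G] in
/-- The membership hypothesis used throughout this package is satisfiable (by the infimum of the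
family): **there is a subgroup `K ⊆ G` with `x ∈ K ↔ x ∈ W` for every open normal `Σ`-index `W`** —
the kernel of the maximal pro-`Σ` quotient `G ↠ P` of [AbsTopI] Def 1.1 (iii).  (No definition is
introduced; consumers obtain `K` from this lemma.) [cite: MochizukiAbsTopI2012, Def 1.1 (iii) p.10] -/
theorem exists_proSigmaKernel (G : Type u) [Group G] [TopologicalSpace G] (S : Set ℕ) :
    ∃ K : Subgroup G, ∀ x, x ∈ K ↔
      ∀ W : Subgroup G, W.Normal → IsOpen (W : Set G) → IsSigmaInteger S W.index → x ∈ W := by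
  refine ⟨sInf {W : Subgroup G | W.Normal ∧ IsOpen (W : Set G) ∧ IsSigmaInteger S W.index}, fun x => ?_⟩
  rw [Subgroup.mem_sInf]
  exact ⟨fun h W hWn hWo hWS => h W ⟨hWn, hWo, hWS⟩, fun h W hW => h W hW.1 hW.2.1 hW.2.2⟩

omit [IsTopologicalGroup G] in
/-- The kernel, taken inside an open subgroup `N` and viewed in `G`: **there is `K_Σ ⊆ N` with
`x ∈ K_Σ ↔ x ∈ W` for every open normal `Σ`-index `W ⊴ N`** (`x ∈ N`) — the subgroup
`Ker(N ↠ P) ⊆ G` of [AbsTopI] Def 1.1 (iii), in the form consumed by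
`isElastic_absoluteGaloisGroup_quotient_proSigmaKernel` / `isAlmostPro_quotient_proSigmaKernel`.
[cite: MochizukiAbsTopI2012, Def 1.1 (iii) p.10] -/
theorem exists_proSigmaKernel_subgroup (N : Subgroup G) (S : Set ℕ) :
    ∃ KS : Subgroup G, KS ≤ N ∧ ∀ x : N, (x : G) ∈ KS ↔
      ∀ W : Subgroup N, W.Normal → IsOpen (W : Set N) → IsSigmaInteger S W.index → x ∈ W := by
  obtain ⟨K', hK'⟩ := exists_proSigmaKernel N S
  refine ⟨K'.map N.subtype, fun x hx => ?_, fun x => ?_⟩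
  · obtain ⟨y, -, rfl⟩ := hx
    exact y.2
  · rw [← hK' x]
    constructor
    · rintro ⟨y, hy, hyx⟩
      have : y = x := Subtype.ext hyx
      exact this ▸ hy
    · intro hx
      exact ⟨x, hx, rfl⟩

end Literature.AnabelianGeometry.AbsoluteAnabelian

end
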